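import Summits.BirchSwinnertonDyer.Rank1Residual.Supersingular.KobayashiMainConjectureX6BSTWScopeS
import Summits.BirchSwinnertonDyer.BirchSwinnertonDyer.Theorems.SignedLowerHalvesKobayashiLowerHalfSemistableScopeAuxFieldThree
import HarnessLib

/-!
# Route `SignedLowerHalves`, crux `KobayashiLowerHalfSemistable` (item stmt-BirchSwinnertonDyer-19000): both halves read
# through the S-SCOPED tier binders — registered stubs `stub_five_le` / `stub_three` VERBATIM, the A6 / D2 consumers
# and the crux BY NAME with NO class-number statement, NO Bhargava–Varma input and NO per-class witness (cell
# `bsd-ssimc`, seat `bsd-ssimc-k3-c2` gen 6; a `--supports … --as helper` file; THEOREMS ONLY; closes nothing)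

PARTITION (cell bsd-ssimc, D-0054): X6 ∧ r = 0 (A6) × 13 (+10~) × p ∈ {3,5} + X6 r1 + literal row D2 —
types-the-object-of; closes NONE; nothing booked. HONEST FRAMING: nothing here proves Kobayashi's conjecture for any
curve; the binders `BurungaleSkinnerTianWan2024_thm13_scopedS_OPEN` (p ≥ 5) / `…_scopedAtThreeS_OPEN` (p = 3) transcribe
an UNREFEREED preprint in the regime the cell verified (REPORT-bstw-6 / -7 / -9) and enter ONLY as hypotheses; BSD is
not proved by any of this; the item stays OPEN.

## What this file says (the kernel state of crux 2 on bstw-MEMO-9's reading; OF RECORD on REPORT-bstw-9 PASS)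

Seat bstw gen 9 proved that the class-number-free auxiliary data S1 ∧ S2 of BSTW II §2.3 exist CLASS-WIDE on X6 at
every odd `p` (`BSTWScope_exists_auxField_of_goodSS`, p438787, from the Literature theorem
`Quadratic.exists_imaginaryQuadratic_split_inert'`, p438352) and ARGUED (bstw-MEMO-9 626211cba73919ef + addA
de517f28a83a79cc + addB b16856770569f647; the referee's REPORT-bstw-9 decides, pending when this file was written) that
the class-number rider (α) of NOTE-W-ref-2 is void at every odd `p`; p438787 / p440592 displayed the resulting readings
INLINE (`hS` / `hS5`, `hS3`). With those readings NAMED — verdict-neutrally, planner ORDERS v12.6 — (companion file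
`KobayashiMainConjectureX6BSTWScopeS.lean`):
* `BSTWScope_hasAuxWitness_of_ram` / `_of_goodSS` — the binders' scope hypothesis `BSTWScope.HasAuxWitness W p` holds
  for every semistable `W` at every odd good supersingular `p` (modularity `hmod` + Diamond/Ribet `hLL`, by name);
* `thm13_scopedS_OPEN_iff_fiveLe` / `thm13_scopedAtThreeS_OPEN_iff_three` — hence, modulo those two PUBLISHED facts,
  each S-scoped binder is EQUIVALENT to the printed claim restricted to its regime with NO scope hypothesis at all:
  on MEMO-9's reading the two tiers ARE the printed claim on `{p ≥ 5} ∪ {p = 3, a₃ = 0}`, tier by tier;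
* `X6_kobayashiMainConjecture_of_thm13_scopedS_OPEN`, `X6_kobayashiLowerDivisibility_…`, `X6_bsdp_…_of_analyticRank_eq_zero`
  (A6 @ p ≥ 5), `X6_bsdp_…_of_corA5_of_analyticRank_eq_one` (D2 / X6 r1 @ p ≥ 5), and the `p = 3` twins
  (`…_scopedAtThreeS_OPEN…`, A6 @ 3) — the class-X6 consumers modulo ONE PRE binder per tier and PUBLISHED facts,
  WITHOUT any per-class witness (the gen-0 / gen-2 per-class L-witness tables become unnecessary);
* `stub_five_le_of_thm13_scopedS_OPEN` / `stub_three_of_thm13_scopedAtThreeS_OPEN` — the REGISTERED stubs of the crux's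
  BC3 skeleton, signatures VERBATIM, each modulo {its S-scoped binder, modularity, Diamond/Ribet} — compare gen 0
  (binder of record + class-wide witness `hwit`), gen 2 (… + CL(p) at p ≥ 5 / Bhargava–Varma at 3): no witness, no
  class-number statement;
* `KobayashiLowerHalfSemistable_of_tiersS_S3` — the crux BY NAME ⟸ {S-scoped tier @ p ≥ 5, S-scoped tier @ 3,
  modularity, Diamond/Ribet}: two PRE tiers + TWO published facts (= p440592's `…_of_scopeS_of_scopeS3` with `hS5`,
  `hS3` named); `KobayashiLowerHalfSemistable_of_tiersS` — the variant keeping the `p = 3` binder OF RECORD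
  (+ Bhargava–Varma for its witness), = p438787's `…_of_scopeS_of_tiers` with `hS` named;
* `KobayashiLowerHalfSemistable_of_thm13_OPEN_via_tiersS_S3` — sanity: both tiers follow from the printed binder, so the
  state of record is never stronger than gen 0's `KobayashiLowerHalfSemistable_of_thm13_OPEN`.

What this is NOT: not a discharge of any binder; not a verification (bstw-MEMO-1…9 / REPORT-bstw-1…9 are); not a
booking; the located residual (3-ii)♭ of the `p = 3` tier is unchanged.

References: [BurungaleSkinnerTianWan2024] Thm. 1.3, II §2.3 (PRE); [Kobayashi2003] Conjecture (p. 2), Thm. 1.2;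
[Wuthrich2014] Prop. 21; [BDKim2013] Cor. 3.15; [Pollack2003]; [BurungaleKobayashiOta2023] Cor. A.5; [Ribet1990] Thm 1.1;
[Diamond1995RefinedSerre] Thm 1.1; [BhargavaVarma2016] Cor. 4 (a); [SkinnerUrban2014] Thm. 2; cell records REPORT-bstw-6
(7a95ba616d84dc36), REPORT-bstw-7 (40fdbe7e627732c4), bstw-MEMO-9 (626211cba73919ef) + addA (de517f28a83a79cc) + addB
(b16856770569f647), REPORT-bstw-9.
-/

set_option autoImplicit false
set_option linter.dupNamespace false

noncomputable section

open scoped Classical MatrixGroups ModularForm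

open CongruenceSubgroup WeierstrassCurve NumberField Literature.NumberTheory.EllipticCurves
  Literature.NumberTheory.EllipticCurves.ModularForms
  Literature.NumberTheory.EllipticCurves.Rank1Residual
  Literature.NumberTheory.EllipticCurves.Rank1Residual.Typed
  Literature.NumberTheory.QuadraticFields
  Summit.BirchSwinnertonDyer.Rank1Residual.Supersingular

namespace Summit.BirchSwinnertonDyer.BirchSwinnertonDyer.Theorems

/-! ### The S-scope hypothesis holds class-wide -/

/-- **The class-number-free scope witness from a (ram) prime, at ANY prime `p`** — p438787's
`BSTWScope_exists_auxField_of_ram` in the binders' currency `BSTWScope.HasAuxWitness`. UNCONDITIONAL; closes nothing.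
[cite: SkinnerUrban2014, Thm. 2 (p. 3), second bullet (shape of (ram) only)] -/
theorem BSTWScope_hasAuxWitness_of_ram (W : WeierstrassCurve ℚ) [W.IsElliptic] [W.IsGloballyMinimal]
    (p : ℕ) [Fact p.Prime] (hram : Ram W p) : BSTWScope.HasAuxWitness W p :=
  BSTWScope_exists_auxField_of_ram W p hram

/-- **The class-number-free scope witness CLASS-WIDE: every semistable `W`, every odd good supersingular `p`**
(modularity `hmod` + Diamond 1995 / Ribet 1990 `hLL`, published, by name) — p438787's
`BSTWScope_exists_auxField_of_goodSS` in the binders' currency. So the S-scoped binders' scope hypothesis is never a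
restriction. Closes nothing. [cite: Ribet1990, Thm. 1.1] [cite: Diamond1995RefinedSerre, Thm. 1.1] -/
theorem BSTWScope_hasAuxWitness_of_goodSS (hmod : exists_isNewformOf)
    (hLL : Literature.NumberTheory.Automorphic.diamond1995_refinedSerre)
    (W : WeierstrassCurve ℚ) [W.IsElliptic] [W.IsGloballyMinimal] (p : ℕ) [Fact p.Prime] (hp2 : p ≠ 2)
    (hsst : Semistable W) (hss : GoodSS W p) : BSTWScope.HasAuxWitness W p :=
  BSTWScope_exists_auxField_of_goodSS hmod hLL W p hp2 hsst hss

/-- **On MEMO-9's reading the `p ≥ 5` tier IS the printed claim at `p ≥ 5`.** Modulo modularity and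
Diamond/Ribet (which make the scope hypothesis free), the `p ≥ 5` S-scoped binder is EQUIVALENT to «for every semistable
`E` and every good supersingular `p ≥ 5`, Kobayashi's main conjecture holds for both signs» — BSTW Thm. 1.3 restricted
to `p ≥ 5`, with no auxiliary hypothesis whatsoever. (Both sides are OPEN claims; a statement about hypotheses, not a
theorem about curves.) [claim: BurungaleSkinnerTianWan2024, status: under-review]
[cite: Kobayashi2003, Conjecture (Main Conjecture) (p. 2)] -/
theorem thm13_scopedS_OPEN_iff_fiveLe (hmod : exists_isNewformOf)
    (hLL : Literature.NumberTheory.Automorphic.diamond1995_refinedSerre) :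
    BurungaleSkinnerTianWan2024_thm13_scopedS_OPEN ↔
      ∀ (W : WeierstrassCurve ℚ) [W.IsElliptic] [W.IsGloballyMinimal] (p : ℕ) [Fact p.Prime],
        5 ≤ p → Semistable W → GoodSS W p → ∀ ε : ℤˣ, KobayashiMainConjecture W p ε := by
  constructor
  · intro h W _ _ p _ h5 hsst hss ε
    exact h W p h5 hsst hss (BSTWScope_hasAuxWitness_of_goodSS hmod hLL W p (by omega) hsst hss) ε
  · intro h W _ _ p _ h5 hsst hss _ ε
    exact h W p h5 hsst hss ε

/-- **Likewise at `p = 3`**: modulo modularity and Diamond/Ribet, the `p = 3` S-scoped binder is EQUIVALENT to BSTW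
Thm. 1.3 restricted to `p = 3`, `a₃ = 0`, with no auxiliary hypothesis. [claim: BurungaleSkinnerTianWan2024, status: under-review]
[cite: Kobayashi2003, Conjecture (Main Conjecture) (p. 2)] -/
theorem thm13_scopedAtThreeS_OPEN_iff_three (hmod : exists_isNewformOf)
    (hLL : Literature.NumberTheory.Automorphic.diamond1995_refinedSerre) :
    BurungaleSkinnerTianWan2024_thm13_scopedAtThreeS_OPEN ↔
      ∀ (W : WeierstrassCurve ℚ) [W.IsElliptic] [W.IsGloballyMinimal] (p : ℕ) [Fact p.Prime],
        p = 3 → Semistable W → GoodSS W p → W.frobeniusTrace 3 = 0 → ∀ ε : ℤˣ, KobayashiMainConjecture W p ε := by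
  constructor
  · intro h W _ _ p _ h3 hsst hss ha3 ε
    exact h W p h3 hsst hss ha3 (BSTWScope_hasAuxWitness_of_goodSS hmod hLL W p (by omega) hsst hss) ε
  · intro h W _ _ p _ h3 hsst hss ha3 _ ε
    exact h W p h3 hsst hss ha3 ε

/-! ### Class-X6 consumers, witness-free -/

/-- **Kobayashi's main conjecture on X6 at `p ≥ 5`, every sign, MODULO the `p ≥ 5` S-scoped binder ALONE**
(+ modularity and Diamond/Ribet by name; NO per-class witness, NO class-number statement). CONDITIONAL; closes nothing.
[claim: BurungaleSkinnerTianWan2024, status: under-review] [cite: Kobayashi2003, Conjecture (Main Conjecture) (p. 2)] -/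
theorem X6_kobayashiMainConjecture_of_thm13_scopedS_OPEN (h : BurungaleSkinnerTianWan2024_thm13_scopedS_OPEN)
    (hmod : exists_isNewformOf) (hLL : Literature.NumberTheory.Automorphic.diamond1995_refinedSerre)
    (W : WeierstrassCurve ℚ) [W.IsElliptic] [W.IsGloballyMinimal] (p : ℕ) [Fact p.Prime]
    (h5 : 5 ≤ p) (hX : ClassX6 W p) (ε : ℤˣ) : KobayashiMainConjecture W p ε :=
  X6.kobayashiMainConjecture_of_thm13_scopedS_OPEN_of_hasAuxWitness W p h h5 hX
    (BSTWScope_hasAuxWitness_of_goodSS hmod hLL W p (by omega) hX.2.1 hX.1) ε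

/-- **The Eisenstein half (the crux's predicate) on X6 at `p ≥ 5`, every sign, MODULO the `p ≥ 5` S-scoped binder
ALONE** (+ modularity, Diamond/Ribet). CONDITIONAL; closes nothing. [claim: BurungaleSkinnerTianWan2024, status: under-review]
[cite: Kobayashi2003, Conjecture (Main Conjecture) (p. 2)] -/
theorem X6_kobayashiLowerDivisibility_of_thm13_scopedS_OPEN (h : BurungaleSkinnerTianWan2024_thm13_scopedS_OPEN)
    (hmod : exists_isNewformOf) (hLL : Literature.NumberTheory.Automorphic.diamond1995_refinedSerre)
    (W : WeierstrassCurve ℚ) [W.IsElliptic] [W.IsGloballyMinimal] (p : ℕ) [Fact p.Prime]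
    (h5 : 5 ≤ p) (hX : ClassX6 W p) (ε : ℤˣ) : KobayashiLowerDivisibility W p ε :=
  kobayashiLowerDivisibility_of_mainConjecture (X6_kobayashiMainConjecture_of_thm13_scopedS_OPEN h hmod hLL W p h5 hX ε)

/-- **Kobayashi's main conjecture on X6 at `p = 3`, every sign, MODULO the `p = 3` S-scoped binder ALONE**
(+ modularity, Diamond/Ribet; NO Bhargava–Varma, NO witness). CONDITIONAL; closes nothing.
[claim: BurungaleSkinnerTianWan2024, status: under-review] [cite: Kobayashi2003, Conjecture (Main Conjecture) (p. 2)] -/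
theorem X6_kobayashiMainConjecture_of_thm13_scopedAtThreeS_OPEN
    (h : BurungaleSkinnerTianWan2024_thm13_scopedAtThreeS_OPEN)
    (hmod : exists_isNewformOf) (hLL : Literature.NumberTheory.Automorphic.diamond1995_refinedSerre)
    (W : WeierstrassCurve ℚ) [W.IsElliptic] [W.IsGloballyMinimal] (p : ℕ) [Fact p.Prime]
    (h3 : p = 3) (hX : ClassX6 W p) (ε : ℤˣ) : KobayashiMainConjecture W p ε :=
  X6.kobayashiMainConjecture_of_thm13_scopedAtThreeS_OPEN_of_hasAuxWitness W p h h3 hX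
    (BSTWScope_hasAuxWitness_of_goodSS hmod hLL W p (by omega) hX.2.1 hX.1) ε

/-- **The Eisenstein half on X6 at `p = 3`, every sign, MODULO the `p = 3` S-scoped binder ALONE** (+ modularity,
Diamond/Ribet). CONDITIONAL; closes nothing. [claim: BurungaleSkinnerTianWan2024, status: under-review]
[cite: Kobayashi2003, Conjecture (Main Conjecture) (p. 2)] -/
theorem X6_kobayashiLowerDivisibility_of_thm13_scopedAtThreeS_OPEN
    (h : BurungaleSkinnerTianWan2024_thm13_scopedAtThreeS_OPEN)
    (hmod : exists_isNewformOf) (hLL : Literature.NumberTheory.Automorphic.diamond1995_refinedSerre)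
    (W : WeierstrassCurve ℚ) [W.IsElliptic] [W.IsGloballyMinimal] (p : ℕ) [Fact p.Prime]
    (h3 : p = 3) (hX : ClassX6 W p) (ε : ℤˣ) : KobayashiLowerDivisibility W p ε :=
  kobayashiLowerDivisibility_of_mainConjecture
    (X6_kobayashiMainConjecture_of_thm13_scopedAtThreeS_OPEN h hmod hLL W p h3 hX ε)

/-- **A6 at `p ≥ 5`: `BSD(E,p)` on X6 ∧ {r_an = 0}, CLASS-WIDE, MODULO the ONE `p ≥ 5` S-scoped PRE binder**,
everything else PUBLISHED and by name (Wuthrich Prop. 21 `hW`, Kobayashi Thm. 1.2 `h12`, B. D. Kim Cor. 3.15 `hKim`,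
Pollack `hPollack`, modularity `hmodP` / `hmod'` / `hmod`, GZK `hGZK`, Diamond/Ribet `hLL`) — NO per-class L-witness
(contrast gen 0's `bsdp_c22678e1_5_of_thm13_scoped_OPEN_of_analyticRank_eq_zero` & co.). Still PRE-tier in the lane's
currency (nothing booked). CONDITIONAL; closes nothing. [claim: BurungaleSkinnerTianWan2024, status: under-review]
[cite: Wuthrich2014, Prop. 21 (p. 400)] [cite: Miller2011LMS, §1 and Def. 1.1] -/
theorem X6_bsdp_of_thm13_scopedS_OPEN_of_analyticRank_eq_zero
    (h : BurungaleSkinnerTianWan2024_thm13_scopedS_OPEN)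
    (hW : Wuthrich2014.sha_dvd_analyticSha)
    (h12 : Kobayashi2003.thm12_signedSelmerDual_finite_torsion)
    (hKim : BDKim2013.cor315_signedCharValue_rankZero)
    (W : WeierstrassCurve ℚ) [W.IsElliptic] [W.IsGloballyMinimal] (p : ℕ) [Fact p.Prime]
    (hPollack : ∀ {N : ℕ} [NeZero N] {f : CuspForm (Gamma0 N) 2},
      pollack_exists_plusMinusPAdicLFunction (W := W) (f := f) (p := p))
    (hmodP : nonempty_modularParametrizationData) (hmod' : hasEntireLFunction_rat)
    (hGZK : rank_eq_analyticRank_of_analyticRank_le_one)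
    (hmod : exists_isNewformOf) (hLL : Literature.NumberTheory.Automorphic.diamond1995_refinedSerre)
    (h5 : 5 ≤ p) (hX : ClassX6 W p) (h0 : W.analyticRank = 0) : BSDp W p :=
  X6.bsdp_of_thm13_scopedS_OPEN_of_hasAuxWitness_of_analyticRank_eq_zero W p h hW h12 hKim hPollack hmodP hmod'
    hGZK h5 hX (BSTWScope_hasAuxWitness_of_goodSS hmod hLL W p (by omega) hX.2.1 hX.1) h0

/-- **A6 at `p = 3`: `BSD(E,3)` on X6 ∧ {r_an = 0}, CLASS-WIDE, MODULO the ONE `p = 3` S-scoped PRE binder** (which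
carries (3-ii)♭; RELAY-6: not bookable on cell verification), everything else PUBLISHED and by name — NO per-class
L-witness, NO Bhargava–Varma (contrast gen 2's twelve `…_c<label>_3` witnesses). CONDITIONAL; closes nothing.
[claim: BurungaleSkinnerTianWan2024, status: under-review] [cite: Wuthrich2014, Prop. 21 (p. 400)]
[cite: Miller2011LMS, §1 and Def. 1.1] -/
theorem X6_bsdp_of_thm13_scopedAtThreeS_OPEN_of_analyticRank_eq_zero
    (h : BurungaleSkinnerTianWan2024_thm13_scopedAtThreeS_OPEN)
    (hW : Wuthrich2014.sha_dvd_analyticSha)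
    (h12 : Kobayashi2003.thm12_signedSelmerDual_finite_torsion)
    (hKim : BDKim2013.cor315_signedCharValue_rankZero)
    (W : WeierstrassCurve ℚ) [W.IsElliptic] [W.IsGloballyMinimal] (p : ℕ) [Fact p.Prime]
    (hPollack : ∀ {N : ℕ} [NeZero N] {f : CuspForm (Gamma0 N) 2},
      pollack_exists_plusMinusPAdicLFunction (W := W) (f := f) (p := p))
    (hmodP : nonempty_modularParametrizationData) (hmod' : hasEntireLFunction_rat)
    (hGZK : rank_eq_analyticRank_of_analyticRank_le_one)
    (hmod : exists_isNewformOf) (hLL : Literature.NumberTheory.Automorphic.diamond1995_refinedSerre)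
    (h3 : p = 3) (hX : ClassX6 W p) (h0 : W.analyticRank = 0) : BSDp W p :=
  X6.bsdp_of_thm13_scopedAtThreeS_OPEN_of_hasAuxWitness_of_analyticRank_eq_zero W p h hW h12 hKim hPollack hmodP hmod'
    hGZK h3 hX (BSTWScope_hasAuxWitness_of_goodSS hmod hLL W p (by omega) hX.2.1 hX.1) h0

/-- **D2 / X6 r1 at `p ≥ 5`: `BSD(E,p)` on X6 ∧ {r_an = 1}, CLASS-WIDE, MODULO the ONE `p ≥ 5` S-scoped PRE binder**,
via Burungale–Kobayashi–Ota 2024 Cor. A.5 (`hA5`, PUB, flags in its docstring), modularity (`hmod'`, `hmod`), GZK and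
Diamond/Ribet — NO per-class L-witness. PRE-tier; nothing booked. CONDITIONAL; closes nothing.
[claim: BurungaleSkinnerTianWan2024, status: under-review] [cite: BurungaleKobayashiOta2023, App. A Cor. A.5]
[cite: Miller2011LMS, §1 and Def. 1.1] -/
theorem X6_bsdp_of_thm13_scopedS_OPEN_of_corA5_of_analyticRank_eq_one
    (h : BurungaleSkinnerTianWan2024_thm13_scopedS_OPEN)
    (hA5 : BurungaleKobayashiOta2024.corA5_pPart_of_signedCharIdeal_eq) (hmod' : hasEntireLFunction_rat)
    (hGZK : rank_eq_analyticRank_of_analyticRank_le_one)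
    (hmod : exists_isNewformOf) (hLL : Literature.NumberTheory.Automorphic.diamond1995_refinedSerre)
    (W : WeierstrassCurve ℚ) [W.IsElliptic] [W.IsGloballyMinimal] (p : ℕ) [Fact p.Prime]
    (h5 : 5 ≤ p) (hX : ClassX6 W p) (h1 : W.analyticRank = 1) : BSDp W p :=
  X6.bsdp_of_thm13_scopedS_OPEN_of_hasAuxWitness_of_corA5_of_analyticRank_eq_one W p h hA5 hmod' hGZK h5 hX
    (BSTWScope_hasAuxWitness_of_goodSS hmod hLL W p (by omega) hX.2.1 hX.1) h1

/-! ### The registered stubs and the crux BY NAME -/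

/-- **`stub_five_le` — the REGISTERED stub of the crux's BC3 skeleton (Lines/birth.lean), signature VERBATIM — MODULO
the `p ≥ 5` S-scoped tier binder and two PUBLISHED facts (modularity, Diamond 1995 / Ribet 1990): NO witness, NO
class-number statement, NO per-class hypothesis.** Lineage: gen 0 `stub_five_le_of_thm13_scoped_OPEN` (binder of
record + class-wide witness `hwit`); gen 2 `…_of_classNumberHypothesis` (… + CL(p), OPEN in print); here, after bstw's
p438352 / p438787 and MEMO-9, the class-number content is gone. CONDITIONAL (`conditional-result`); the stub is not
discharged. [claim: BurungaleSkinnerTianWan2024, status: under-review] [cite: Kobayashi2003, Conjecture (Main Conjecture) (p. 2)]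
[cite: Ribet1990, Thm. 1.1] -/
theorem stub_five_le_of_thm13_scopedS_OPEN (hBSTW : BurungaleSkinnerTianWan2024_thm13_scopedS_OPEN)
    (hmod : exists_isNewformOf) (hLL : Literature.NumberTheory.Automorphic.diamond1995_refinedSerre) :
    ∀ (W : WeierstrassCurve ℚ) [W.IsElliptic] [W.IsGloballyMinimal] (p : ℕ) [Fact p.Prime],
      p ≠ 2 → Literature.NumberTheory.EllipticCurves.Rank1Residual.ClassX6 W p → 5 ≤ p →
      ∃ ε : ℤˣ, Summit.BirchSwinnertonDyer.Rank1Residual.Supersingular.KobayashiLowerDivisibility W p ε := by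
  intro W _ _ p _ _ hX h5
  exact ⟨1, X6_kobayashiLowerDivisibility_of_thm13_scopedS_OPEN hBSTW hmod hLL W p h5 hX 1⟩

/-- **`stub_three` — the REGISTERED stub at `p = 3`, signature VERBATIM — MODULO the `p = 3` S-scoped tier binder and
two PUBLISHED facts (modularity, Diamond/Ribet): NO witness, NO Bhargava–Varma, NO per-class hypothesis.** Lineage:
gen 2 `stub_three_of_thm13_scopedAtThree_OPEN` (binder of record + class-wide witness at 3) and
`…_of_published` (… witness from Bhargava–Varma 2016 Cor. 4 (a)). CONDITIONAL (`conditional-result`); the stub is not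
discharged. [claim: BurungaleSkinnerTianWan2024, status: under-review] [cite: Kobayashi2003, Conjecture (Main Conjecture) (p. 2)]
[cite: Ribet1990, Thm. 1.1] -/
theorem stub_three_of_thm13_scopedAtThreeS_OPEN (hBSTW : BurungaleSkinnerTianWan2024_thm13_scopedAtThreeS_OPEN)
    (hmod : exists_isNewformOf) (hLL : Literature.NumberTheory.Automorphic.diamond1995_refinedSerre) :
    ∀ (W : WeierstrassCurve ℚ) [W.IsElliptic] [W.IsGloballyMinimal],
      Literature.NumberTheory.EllipticCurves.Rank1Residual.ClassX6 W 3 →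
      ∃ ε : ℤˣ, Summit.BirchSwinnertonDyer.Rank1Residual.Supersingular.KobayashiLowerDivisibility W 3 ε := by
  intro W _ _ hX
  haveI : Fact (Nat.Prime 3) := ⟨Nat.prime_three⟩
  exact ⟨1, X6_kobayashiLowerDivisibility_of_thm13_scopedAtThreeS_OPEN hBSTW hmod hLL W 3 rfl hX 1⟩

/-- **The crux BY NAME on bstw-MEMO-9's reading (kernel state of record on REPORT-bstw-9 PASS): two S-scoped PRE tier
binders (@ `p ≥ 5`; @ `p = 3`, resting on (3-ii)♭) + TWO PUBLISHED facts (modularity; Diamond 1995 / Ribet 1990) — NO class-number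
statement, NO Bhargava–Varma, NO per-class witness.** (= p440592's `KobayashiLowerHalfSemistable_of_scopeS_of_scopeS3`
with its inline `hS5`, `hS3` NAMED; compare gen 2's `…_of_tiers_of_classNumberHypothesis`, whose `hCL` and `hBV` are now
superfluous.) CONDITIONAL (`conditional-result`); the item stays OPEN. [claim: BurungaleSkinnerTianWan2024, status: under-review]
[cite: Kobayashi2003, Conjecture (Main Conjecture) (p. 2)] [cite: Ribet1990, Thm. 1.1] [cite: Diamond1995RefinedSerre, Thm. 1.1] -/
theorem KobayashiLowerHalfSemistable_of_tiersS_S3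
    (hBSTW5 : BurungaleSkinnerTianWan2024_thm13_scopedS_OPEN)
    (hBSTW3 : BurungaleSkinnerTianWan2024_thm13_scopedAtThreeS_OPEN) (hmod : exists_isNewformOf)
    (hLL : Literature.NumberTheory.Automorphic.diamond1995_refinedSerre) :
    Summit.BirchSwinnertonDyer.BirchSwinnertonDyer.Theses.SignedLowerHalves.KobayashiLowerHalfSemistable :=
  KobayashiLowerHalfSemistable_of_scopeS_of_scopeS3
    (fun W _ _ p _ h5 hsst hss hw ε => hBSTW5 W p h5 hsst hss hw ε)
    (fun W _ _ p _ h3 hsst hss ha3 hw ε => hBSTW3 W p h3 hsst hss ha3 hw ε) hmod hLL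

/-- **Variant keeping the `p = 3` binder OF RECORD** (whose witness carries `3 ∤ h_L`, discharged class-wide by
Bhargava–Varma 2016 Cor. 4 (a), `hBV`): crux BY NAME ⟸ {S-scoped tier @ p ≥ 5, tier @ 3 of record, modularity,
Diamond/Ribet, Bhargava–Varma} (= p438787's `KobayashiLowerHalfSemistable_of_scopeS_of_tiers` with `hS` named).
CONDITIONAL (`conditional-result`); the item stays OPEN. [claim: BurungaleSkinnerTianWan2024, status: under-review]
[cite: Kobayashi2003, Conjecture (Main Conjecture) (p. 2)] [cite: BhargavaVarma2016, Cor. 4 (a) (p. 237)] -/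
theorem KobayashiLowerHalfSemistable_of_tiersS
    (hBSTW5 : BurungaleSkinnerTianWan2024_thm13_scopedS_OPEN)
    (hBSTW3 : BurungaleSkinnerTianWan2024_thm13_scopedAtThree_OPEN) (hmod : exists_isNewformOf)
    (hLL : Literature.NumberTheory.Automorphic.diamond1995_refinedSerre)
    (hBV : bhargavaVarma2016_exists_imaginaryQuadratic_split_inert_three_not_dvd_classNumber) :
    Summit.BirchSwinnertonDyer.BirchSwinnertonDyer.Theses.SignedLowerHalves.KobayashiLowerHalfSemistable :=
  KobayashiLowerHalfSemistable_of_scopeS_of_tiers (fun W _ _ p _ h5 hsst hss hw ε => hBSTW5 W p h5 hsst hss hw ε)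
    hBSTW3 hmod hLL hBV

/-- **Both S-scoped tiers are implied by the printed binder** — so the state of record is never stronger than taking
BSTW Thm. 1.3 as printed (gen 0's `KobayashiLowerHalfSemistable_of_thm13_OPEN`): crux BY NAME ⟸ {printed binder,
modularity, Diamond/Ribet}. Sanity composition; closes nothing. [claim: BurungaleSkinnerTianWan2024, status: under-review] -/
theorem KobayashiLowerHalfSemistable_of_thm13_OPEN_via_tiersS_S3 (h : BurungaleSkinnerTianWan2024_thm13_OPEN)
    (hmod : exists_isNewformOf) (hLL : Literature.NumberTheory.Automorphic.diamond1995_refinedSerre) :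
    Summit.BirchSwinnertonDyer.BirchSwinnertonDyer.Theses.SignedLowerHalves.KobayashiLowerHalfSemistable :=
  KobayashiLowerHalfSemistable_of_tiersS_S3 (thm13_scopedS_OPEN_of_thm13_OPEN h)
    (thm13_scopedAtThreeS_OPEN_of_thm13_OPEN h) hmod hLL

end Summit.BirchSwinnertonDyer.BirchSwinnertonDyer.Theorems

end
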